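import Literature.Analysis.FunctionSpaces.TorusLinearisedNSBackwardUniqueness
import Literature.Analysis.FunctionSpaces.TorusClassicalNSSecondVariation
import Summits.AnomalousDissipation.AnomalousDissipation.Theorems.BaireTransferDenseLoudDesignerForcesErgodicH3Smoothing

/-!
# The linearised flow along an NS phase: injectivity, and uniform first- and second-order Taylor remainders of
# the solution map along `K` (block N2 of stub `stub_smoothModel`, line `ergodic-budget-selection-closing`, crux
# `BaireTransfer.DenseLoudDesignerForces`, stmt-AnomalousDissipation-1143)

Summit-side corollaries, in the line vocabulary `IsNSPhase` / `IsLinearizedNSSolutionOn` (`…ErgodicLine.lean`), of the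
Literature linearisation theory of classical Navier–Stokes solutions on `T³` (all `Literature/Analysis/FunctionSpaces/`):
`TorusLinearisedNSBackwardUniqueness` (p124539), `TorusClassicalNSLinearisation` (p124352), `…LinearisationH1` (p125142),
`TorusLinearisedNSBaseDependence` (p125260), `TorusClassicalNSSecondVariation` (p125584), fed with the uniform sup /
`W^{1,∞}` bounds of `…ErgodicH2Smoothing` / `…ErgodicH3Smoothing` (N1) after a time lapse `τ₀ > 0`:

* `IsLinearizedNSSolutionOn.eq_of_eq` — INJECTIVITY of the derivative cocycle: two linearised solutions along a classical
  trajectory on `[0, ∞)` which agree at one time agree at all times (forward AND backward uniqueness, `ν > 0`);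
* `IsNSPhase.exists_taylorRemainder_le` — for `τ₀, τ > 0` there is `K₁` such that for all `x, y ∈ K`, all classical
  trajectories `u_x`, `u_y`, every anchor `a ≥ τ₀` and every linearised solution `w` along `u_x` on `[a, a + τ]` with
  `w(a) = (u_y − u_x)(a)`: `‖(u_y − u_x − w)(t)‖²_{L²} + ‖∇(u_y − u_x − w)(t)‖₂² ≤ K₁ ‖(u_y − u_x)(a)‖⁴_{H¹}` on `[a, a + τ]`
  (the linearised flow is the Fréchet derivative of the solution map in `H¹`, uniformly along `K`);
* `IsNSPhase.exists_linearised_sub_le` — continuity of the derivative in the base point: for linearised `w_x` along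
  `u_x`, `w_y` along `u_y` on `[a, a + τ]` with the same datum `ξ`, `‖(w_y − w_x)(t)‖²_{L²} ≤ K₂ ‖(u_y − u_x)(a)‖²_{H¹} ‖ξ‖²_{H¹}`;
* `IsNSPhase.exists_secondRemainder_le` — second order: with the halved second variation `ζ` (linearised equation along
  `u_x` with source `−(w·∇)w`, `ζ(a) = 0`), `‖(u_y − u_x − w − ζ)(t)‖²_{L²} ≤ K₃ ‖(u_y − u_x)(a)‖⁶_{H¹}`.

Existence of `w`, `ζ` is NOT asserted (block N4e).  References: Constantin–Foias, *Navier–Stokes Equations* (1988)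
Ch. 12 Thm 12.2, Ch. 14 (14.2)–(14.6), Lemma 14.3; Temam, *Infinite-Dimensional Dynamical Systems* (1997) Ch. VI (3.12), §8.
-/

-- `Summit.<Summit>.<Problem>` is the tree's mandated summit-side namespace (CONVENTIONS §2); for this
-- single-conjunct summit the two coincide, so the duplicate is deliberate.
set_option linter.dupNamespace false

noncomputable section

open scoped BigOperators Topology ENNReal InnerProductSpace
open Filter Set Function MeasureTheory

namespace Summit.AnomalousDissipation.AnomalousDissipation.Theorems.DenseLoudDesignerForces.Ergodic

open Literature.Analysis.FunctionSpaces Literature.Analysis.FunctionSpaces.Torus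
open Literature.Analysis.FluidPDE Literature.Analysis.FluidPDE.Torus
open Summit.AnomalousDissipation.AnomalousDissipation.Theses.BaireTransfer
open Summit.AnomalousDissipation.AnomalousDissipation.Theorems.DenseLoudDesignerForces.Negative

variable {ν : ℝ} {F : (UnitAddTorus (Fin 3)) → (EuclideanSpace ℝ (Fin 3))} {K : Set Hsp} {φ : ℝ → Hsp → Hsp}

/-- **Injectivity of the derivative cocycle** (Constantin–Foias 1988, Ch. 14 after (14.6); Lian–Young's standing
hypothesis): along a classical trajectory `(u, p)` on `[0, ∞)` (`ν > 0`), two solutions of the linearised equation which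
agree at some time `t₀ ≥ 0` agree at every `t ≥ 0` (`Torus.linearisedNS_eq_of_eq_Ici`: forward uniqueness by the energy
method, backward uniqueness by log-convexity). [cite: ConstantinFoiasNSE1988, Ch. 12 Theorem 12.2] -/
theorem IsLinearizedNSSolutionOn.eq_of_eq (hν : 0 < ν) {f : ℝ → (UnitAddTorus (Fin 3)) → (EuclideanSpace ℝ (Fin 3))}
    {u w₁ w₂ : ℝ → (UnitAddTorus (Fin 3)) → (EuclideanSpace ℝ (Fin 3))} {p q₁ q₂ : ℝ → (UnitAddTorus (Fin 3)) → ℝ}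
    (hu : IsClassicalNSSolutionOn (Ici 0) ν f u p) (h₁ : IsLinearizedNSSolutionOn (Ici 0) ν u w₁ q₁)
    (h₂ : IsLinearizedNSSolutionOn (Ici 0) ν u w₂ q₂) {t₀ : ℝ} (ht₀ : 0 ≤ t₀) (h0 : w₁ t₀ = w₂ t₀) {t : ℝ}
    (ht : 0 ≤ t) : w₁ t = w₂ t :=
  linearisedNS_eq_of_eq_Ici hν hu.smooth_velocity hu.divFree h₁.1 h₁.2.1 h₁.2.2.1 h₁.2.2.2.2 h₂.1 h₂.2.1 h₂.2.2.1
    h₂.2.2.2.2 ht₀ h0 ht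

/-- Coefficient bounds along the phase after the lapse `τ₀`: a sup bound `M`, a nonnegative `W^{1,∞}` bound `M₁`. -/
private theorem IsNSPhase.exists_coeff_bounds (hν : 0 < ν) (hK : IsNSPhase ν F K φ) {τ₀ : ℝ} (hτ₀ : 0 < τ₀) :
    ∃ M M₁ : ℝ, 0 ≤ M₁ ∧ ∀ x ∈ K, ∀ (u : ℝ → (UnitAddTorus (Fin 3)) → (EuclideanSpace ℝ (Fin 3)))
      (p : ℝ → (UnitAddTorus (Fin 3)) → ℝ), IsClassicalNSSolutionOn (Ici 0) ν (fun _ => F) u p →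
      (∀ t : ℝ, 0 ≤ t → rep (φ t x) =ᵐ[volume] u t) →
      ∀ t : ℝ, τ₀ ≤ t → (∀ y, ‖u t y‖ ≤ M) ∧ ∀ (k : Fin 3) (y : UnitAddTorus (Fin 3)), ‖partialDeriv k (u t) y‖ ≤ M₁ := by
  obtain ⟨M, hM⟩ := hK.exists_forall_norm_le hν hτ₀
  obtain ⟨M₁, hM₁⟩ := hK.exists_forall_norm_partialDeriv_le hν hτ₀
  exact ⟨M, max M₁ 0, le_max_right _ _, fun x hx u p hsol hrep t ht =>
    ⟨hM x hx u p hsol hrep t ht, fun k y => (hM₁ x hx u p hsol hrep t ht k y).trans (le_max_left _ _)⟩⟩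

/-- **Uniform first-order Taylor remainder of the solution map along an NS phase (Fréchet differentiability in `H¹`).**
For an NS phase `(K, φ)` at viscosity `ν > 0` and lapses `τ₀, τ > 0` there is `K₁` such that: for all `x, y ∈ K`, all
classical trajectories `(u_x, p_x)` of `x` and `(u_y, p_y)` of `y`, every anchor `a ≥ τ₀` and every solution `(w, q)` of
the linearised equation along `u_x` on `[a, a + τ]` with `w(a) = u_y(a) − u_x(a)`, for all `t ∈ [a, a + τ]`,
`∫‖(u_y − u_x − w)(t)‖² + ‖∇(u_y − u_x − w)(t)‖₂² ≤ K₁ (∫‖(u_y − u_x)(a)‖² + ‖∇(u_y − u_x)(a)‖₂²)²`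
(`Torus.IsClassicalNSSolutionOn.exists_h1_sub_sub_le` with the N1 bounds). [cite: ConstantinFoiasNSE1988, Ch. 14 Lemma 14.3 (14.10)] -/
theorem IsNSPhase.exists_taylorRemainder_le (hν : 0 < ν) (hK : IsNSPhase ν F K φ) {τ₀ τ : ℝ} (hτ₀ : 0 < τ₀)
    (hτ : 0 < τ) :
    ∃ K₁ : ℝ, ∀ x ∈ K, ∀ y ∈ K, ∀ (ux uy : ℝ → (UnitAddTorus (Fin 3)) → (EuclideanSpace ℝ (Fin 3)))
      (px py : ℝ → (UnitAddTorus (Fin 3)) → ℝ),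
      IsClassicalNSSolutionOn (Ici 0) ν (fun _ => F) ux px → (∀ t : ℝ, 0 ≤ t → rep (φ t x) =ᵐ[volume] ux t) →
      IsClassicalNSSolutionOn (Ici 0) ν (fun _ => F) uy py → (∀ t : ℝ, 0 ≤ t → rep (φ t y) =ᵐ[volume] uy t) →
      ∀ a : ℝ, τ₀ ≤ a → ∀ (w : ℝ → (UnitAddTorus (Fin 3)) → (EuclideanSpace ℝ (Fin 3))) (q : ℝ → (UnitAddTorus (Fin 3)) → ℝ),
        IsLinearizedNSSolutionOn (Icc a (a + τ)) ν ux w q → (∀ z, w a z = uy a z - ux a z) →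
        ∀ t ∈ Icc a (a + τ), (∫ z, ‖uy t z - ux t z - w t z‖ ^ 2) + gradNormSq (fun z => uy t z - ux t z - w t z) ≤
          K₁ * ((∫ z, ‖uy a z - ux a z‖ ^ 2) + gradNormSq (fun z => uy a z - ux a z)) ^ 2 := by
  obtain ⟨M, M₁, hM₁0, hB⟩ := hK.exists_coeff_bounds hν hτ₀
  obtain ⟨K₁, -, hK₁⟩ := IsClassicalNSSolutionOn.exists_h1_sub_sub_le (d := Fin 3) (Fintype.card_fin 3) hν
    (by positivity : (0 : ℝ) ≤ 3 * M₁) hτ M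
  refine ⟨K₁, fun x hx y hy ux uy px py hsx hrx hsy hry a ha w q hw h0 t ht => ?_⟩
  have hsub : Icc a (a + τ) ⊆ Ici 0 := fun s hs => mem_Ici.2 (by linarith [hs.1])
  have hU : UniqueDiffOn ℝ (Icc a (a + τ)) := uniqueDiffOn_Icc (by linarith)
  have hsum : ∑ _i : Fin 3, M₁ ≤ 3 * M₁ := by simp
  exact hK₁ (hsx.mono hsub hU) (hsy.mono hsub hU)
    (fun s hs => hasZeroMean_of_rep_ae_eq (φ s x) (hrx s (hsub hs)))
    (fun s hs => hasZeroMean_of_rep_ae_eq (φ s y) (hry s (hsub hs)))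
    (fun s hs => (hB x hx ux px hsx hrx s (ha.trans hs.1)).1) (fun s hs => (hB y hy uy py hsy hry s (ha.trans hs.1)).1)
    (fun i s hs z => (hB x hx ux px hsx hrx s (ha.trans hs.1)).2 i z) hsum hw.1 hw.2.1 hw.2.2.1 hw.2.2.2.2 h0 t ht

/-- **Continuity of the derivative in the base point along an NS phase.** For `τ₀, τ > 0` there is `K₂` such that: for
`x, y ∈ K` with trajectories `u_x`, `u_y`, an anchor `a ≥ τ₀`, and linearised solutions `(w_x, q_x)` along `u_x`,
`(w_y, q_y)` along `u_y` on `[a, a + τ]` with the same datum `w_x(a) = w_y(a)`, for all `t ∈ [a, a + τ]`,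
`∫‖(w_y − w_x)(t)‖² ≤ K₂ (∫‖(u_y − u_x)(a)‖² + ‖∇(u_y − u_x)(a)‖₂²)(∫‖w_y(a)‖² + ‖∇w_y(a)‖₂²)`
(`Torus.IsClassicalNSSolutionOn.exists_linearisedNS_sub_sq_le`). [folklore] -/
theorem IsNSPhase.exists_linearised_sub_le (hν : 0 < ν) (hK : IsNSPhase ν F K φ) {τ₀ τ : ℝ} (hτ₀ : 0 < τ₀)
    (hτ : 0 < τ) :
    ∃ K₂ : ℝ, ∀ x ∈ K, ∀ y ∈ K, ∀ (ux uy : ℝ → (UnitAddTorus (Fin 3)) → (EuclideanSpace ℝ (Fin 3)))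
      (px py : ℝ → (UnitAddTorus (Fin 3)) → ℝ),
      IsClassicalNSSolutionOn (Ici 0) ν (fun _ => F) ux px → (∀ t : ℝ, 0 ≤ t → rep (φ t x) =ᵐ[volume] ux t) →
      IsClassicalNSSolutionOn (Ici 0) ν (fun _ => F) uy py → (∀ t : ℝ, 0 ≤ t → rep (φ t y) =ᵐ[volume] uy t) →
      ∀ a : ℝ, τ₀ ≤ a → ∀ (wx wy : ℝ → (UnitAddTorus (Fin 3)) → (EuclideanSpace ℝ (Fin 3)))
        (qx qy : ℝ → (UnitAddTorus (Fin 3)) → ℝ),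
        IsLinearizedNSSolutionOn (Icc a (a + τ)) ν ux wx qx → IsLinearizedNSSolutionOn (Icc a (a + τ)) ν uy wy qy →
        wx a = wy a →
        ∀ t ∈ Icc a (a + τ), ∫ z, ‖wy t z - wx t z‖ ^ 2 ≤
          K₂ * ((∫ z, ‖uy a z - ux a z‖ ^ 2) + gradNormSq (fun z => uy a z - ux a z)) *
            ((∫ z, ‖wy a z‖ ^ 2) + gradNormSq (wy a)) := by
  obtain ⟨M, M₁, hM₁0, hB⟩ := hK.exists_coeff_bounds hν hτ₀
  obtain ⟨K₂, -, hK₂⟩ := IsClassicalNSSolutionOn.exists_linearisedNS_sub_sq_le (d := Fin 3) (Fintype.card_fin 3) hν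
    (by positivity : (0 : ℝ) ≤ 3 * M₁) hτ M
  refine ⟨K₂, fun x hx y hy ux uy px py hsx hrx hsy hry a ha wx wy qx qy hwx hwy h0 t ht => ?_⟩
  have hsub : Icc a (a + τ) ⊆ Ici 0 := fun s hs => mem_Ici.2 (by linarith [hs.1])
  have hU : UniqueDiffOn ℝ (Icc a (a + τ)) := uniqueDiffOn_Icc (by linarith)
  have hsum : ∑ _i : Fin 3, M₁ ≤ 3 * M₁ := by simp
  exact hK₂ (hsx.mono hsub hU) (hsy.mono hsub hU)
    (fun s hs => hasZeroMean_of_rep_ae_eq (φ s x) (hrx s (hsub hs)))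
    (fun s hs => hasZeroMean_of_rep_ae_eq (φ s y) (hry s (hsub hs)))
    (fun s hs => (hB y hy uy py hsy hry s (ha.trans hs.1)).1)
    (fun i s hs z => (hB x hx ux px hsx hrx s (ha.trans hs.1)).2 i z) hsum
    (fun i s hs z => (hB y hy uy py hsy hry s (ha.trans hs.1)).2 i z) hsum
    hwx.1 hwx.2.1 hwx.2.2.1 hwx.2.2.2.2 hwy.1 hwy.2.1 hwy.2.2.1 hwy.2.2.2.1 hwy.2.2.2.2 h0 t ht

/-- **Uniform second-order Taylor remainder of the solution map along an NS phase.** For `τ₀, τ > 0` there is `K₃` such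
that: for `x, y ∈ K` with trajectories `u_x`, `u_y`, an anchor `a ≥ τ₀`, a linearised solution `(w, q)` along `u_x` on
`[a, a + τ]` with `w(a) = (u_y − u_x)(a)`, and a smooth divergence-free solution `(ζ, π)` of the linearised equation along
`u_x` with the source `−(w·∇)w` and `ζ(a) = 0` (the halved second variation), for all `t ∈ [a, a + τ]`,
`∫‖(u_y − u_x − w − ζ)(t)‖² ≤ K₃ (∫‖(u_y − u_x)(a)‖² + ‖∇(u_y − u_x)(a)‖₂²)³`
(`Torus.IsClassicalNSSolutionOn.exists_integral_norm_secondRemainder_sq_le`). [cite: Temam1997, Ch. VI §3.1 (3.12)] -/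
theorem IsNSPhase.exists_secondRemainder_le (hν : 0 < ν) (hK : IsNSPhase ν F K φ) {τ₀ τ : ℝ} (hτ₀ : 0 < τ₀)
    (hτ : 0 < τ) :
    ∃ K₃ : ℝ, ∀ x ∈ K, ∀ y ∈ K, ∀ (ux uy : ℝ → (UnitAddTorus (Fin 3)) → (EuclideanSpace ℝ (Fin 3)))
      (px py : ℝ → (UnitAddTorus (Fin 3)) → ℝ),
      IsClassicalNSSolutionOn (Ici 0) ν (fun _ => F) ux px → (∀ t : ℝ, 0 ≤ t → rep (φ t x) =ᵐ[volume] ux t) →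
      IsClassicalNSSolutionOn (Ici 0) ν (fun _ => F) uy py → (∀ t : ℝ, 0 ≤ t → rep (φ t y) =ᵐ[volume] uy t) →
      ∀ a : ℝ, τ₀ ≤ a → ∀ (w ζ : ℝ → (UnitAddTorus (Fin 3)) → (EuclideanSpace ℝ (Fin 3)))
        (q π : ℝ → (UnitAddTorus (Fin 3)) → ℝ),
        IsLinearizedNSSolutionOn (Icc a (a + τ)) ν ux w q → (∀ z, w a z = uy a z - ux a z) →
        IsSmoothSpaceTimeOn (Icc a (a + τ)) ζ → IsSmoothSpaceTimeOn (Icc a (a + τ)) π →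
        (∀ t ∈ Icc a (a + τ), IsDivFree (ζ t)) →
        (∀ t ∈ Icc a (a + τ), ∀ z, Torus.timeDerivWithin (Icc a (a + τ)) ζ t z + convect (ux t) (ζ t) z +
          convect (ζ t) (ux t) z = ν • laplacian (ζ t) z - Torus.gradient (π t) z + -convect (w t) (w t) z) →
        (∀ z, ζ a z = 0) →
        ∀ t ∈ Icc a (a + τ), ∫ z, ‖uy t z - ux t z - w t z - ζ t z‖ ^ 2 ≤
          K₃ * ((∫ z, ‖uy a z - ux a z‖ ^ 2) + gradNormSq (fun z => uy a z - ux a z)) ^ 3 := by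
  obtain ⟨M, M₁, hM₁0, hB⟩ := hK.exists_coeff_bounds hν hτ₀
  obtain ⟨K₃, -, hK₃⟩ := IsClassicalNSSolutionOn.exists_integral_norm_secondRemainder_sq_le (d := Fin 3)
    (Fintype.card_fin 3) hν (by positivity : (0 : ℝ) ≤ 3 * M₁) hτ M
  refine ⟨K₃, fun x hx y hy ux uy px py hsx hrx hsy hry a ha w ζ q π hw h0 hζ hπ hζdiv hlinζ hζ0 t ht => ?_⟩
  have hsub : Icc a (a + τ) ⊆ Ici 0 := fun s hs => mem_Ici.2 (by linarith [hs.1])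
  have hU : UniqueDiffOn ℝ (Icc a (a + τ)) := uniqueDiffOn_Icc (by linarith)
  have hsum : ∑ _i : Fin 3, M₁ ≤ 3 * M₁ := by simp
  exact hK₃ (hsx.mono hsub hU) (hsy.mono hsub hU)
    (fun s hs => hasZeroMean_of_rep_ae_eq (φ s x) (hrx s (hsub hs)))
    (fun s hs => hasZeroMean_of_rep_ae_eq (φ s y) (hry s (hsub hs)))
    (fun s hs => (hB x hx ux px hsx hrx s (ha.trans hs.1)).1) (fun s hs => (hB y hy uy py hsy hry s (ha.trans hs.1)).1)
    (fun i s hs z => (hB x hx ux px hsx hrx s (ha.trans hs.1)).2 i z) hsum hw.1 hw.2.1 hw.2.2.1 hw.2.2.2.1 hw.2.2.2.2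
    h0 hζ hπ hζdiv hlinζ hζ0 t ht

/-- **Tools stub of block N2 (`stub_ergodicLinearisationTools`, crux stmt-AnomalousDissipation-1143, line
`ergodic-budget-selection-closing`)**: the conjunction of the four statements proved above — injectivity of the derivative
cocycle, and the uniform first-order remainder, derivative-continuity and second-order remainder estimates of the NS_ν
solution map along an NS phase. [folklore] -/
theorem stub_ergodicLinearisationTools : (∀ {ν : ℝ}, 0 < ν → ∀ {f u w₁ w₂ : ℝ → (UnitAddTorus (Fin 3)) → (EuclideanSpace ℝ (Fin 3))} {p q₁ q₂ : ℝ → (UnitAddTorus (Fin 3)) → ℝ}, IsClassicalNSSolutionOn (Ici 0) ν f u p → IsLinearizedNSSolutionOn (Ici 0) ν u w₁ q₁ → IsLinearizedNSSolutionOn (Ici 0) ν u w₂ q₂ → ∀ {t₀ : ℝ}, 0 ≤ t₀ → w₁ t₀ = w₂ t₀ → ∀ {t : ℝ}, 0 ≤ t → w₁ t = w₂ t) ∧ (∀ {ν : ℝ} {F : (UnitAddTorus (Fin 3)) → (EuclideanSpace ℝ (Fin 3))} {K : Set Hsp} {φ : ℝ → Hsp → Hsp}, 0 < ν → IsNSPhase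 ν F K φ → ∀ {τ₀ τ : ℝ}, 0 < τ₀ → 0 < τ → ∃ K₁ : ℝ, ∀ x ∈ K, ∀ y ∈ K, ∀ (ux uy : ℝ → (UnitAddTorus (Fin 3)) → (EuclideanSpace ℝ (Fin 3))) (px py : ℝ → (UnitAddTorus (Fin 3)) → ℝ), IsClassicalNSSolutionOn (Ici 0) ν (fun _ => F) ux px → (∀ t : ℝ, 0 ≤ t → rep (φ t x) =ᵐ[volume] ux t) → IsClassicalNSSolutionOn (Ici 0) ν (fun _ => F) uy py → (∀ t : ℝ, 0 ≤ t → rep (φ t y) =ᵐ[volume] uy t) → ∀ a : ℝ, τ₀ ≤ a → ∀ (w : ℝ → (UnitAddTorus (Fin 3)) → (EuclideanSpace ℝ (Fin 3))) (q : ℝ → (UnitAddTorus (Fin 3)) → ℝ), IsLinearizedNSSolutionOn (Icc a (a + τ)) ν ux w q → (∀ z, w a z = uy a z - ux a z) → ∀ t ∈ Icc a (a + τ), (∫ z, ‖uy t z - ux t z - w t z‖ ^ 2) + gradNormSq (fun z => uy t z - ux t z - w t z) ≤ K₁ * ((∫ z, ‖uy a z - ux a z‖ ^ 2) + gradNormSq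 (fun z => uy a z - ux a z)) ^ 2) ∧ (∀ {ν : ℝ} {F : (UnitAddTorus (Fin 3)) → (EuclideanSpace ℝ (Fin 3))} {K : Set Hsp} {φ : ℝ → Hsp → Hsp}, 0 < ν → IsNSPhase ν F K φ → ∀ {τ₀ τ : ℝ}, 0 < τ₀ → 0 < τ → ∃ K₂ : ℝ, ∀ x ∈ K, ∀ y ∈ K, ∀ (ux uy : ℝ → (UnitAddTorus (Fin 3)) → (EuclideanSpace ℝ (Fin 3))) (px py : ℝ → (UnitAddTorus (Fin 3)) → ℝ), IsClassicalNSSolutionOn (Ici 0) ν (fun _ => F) ux px → (∀ t : ℝ, 0 ≤ t → rep (φ t x) =ᵐ[volume] ux t) → IsClassicalNSSolutionOn (Ici 0) ν (fun _ => F) uy py → (∀ t : ℝ, 0 ≤ t → rep (φ t y) =ᵐ[volume] uy t) → ∀ a : ℝ, τ₀ ≤ a → ∀ (wx wy : ℝ → (UnitAddTorus (Fin 3)) → (EuclideanSpace ℝ (Fin 3))) (qx qy : ℝ → (UnitAddTorus (Fin 3)) → ℝ), IsLinearizedNSSolutionOn (Icc a (a + τ)) ν ux wx qx → IsLinearizedNSSolutionOn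 (Icc a (a + τ)) ν uy wy qy → wx a = wy a → ∀ t ∈ Icc a (a + τ), ∫ z, ‖wy t z - wx t z‖ ^ 2 ≤ K₂ * ((∫ z, ‖uy a z - ux a z‖ ^ 2) + gradNormSq (fun z => uy a z - ux a z)) * ((∫ z, ‖wy a z‖ ^ 2) + gradNormSq (wy a))) ∧ (∀ {ν : ℝ} {F : (UnitAddTorus (Fin 3)) → (EuclideanSpace ℝ (Fin 3))} {K : Set Hsp} {φ : ℝ → Hsp → Hsp}, 0 < ν → IsNSPhase ν F K φ → ∀ {τ₀ τ : ℝ}, 0 < τ₀ → 0 < τ → ∃ K₃ : ℝ, ∀ x ∈ K, ∀ y ∈ K, ∀ (ux uy : ℝ → (UnitAddTorus (Fin 3)) → (EuclideanSpace ℝ (Fin 3))) (px py : ℝ → (UnitAddTorus (Fin 3)) → ℝ), IsClassicalNSSolutionOn (Ici 0) ν (fun _ => F) ux px → (∀ t : ℝ, 0 ≤ t → rep (φ t x) =ᵐ[volume] ux t) → IsClassicalNSSolutionOn (Ici 0) ν (fun _ => F) uy py → (∀ t : ℝ, 0 ≤ t → rep (φ t y) =ᵐ[volume] uy t) → ∀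 a : ℝ, τ₀ ≤ a → ∀ (w ζ : ℝ → (UnitAddTorus (Fin 3)) → (EuclideanSpace ℝ (Fin 3))) (q π : ℝ → (UnitAddTorus (Fin 3)) → ℝ), IsLinearizedNSSolutionOn (Icc a (a + τ)) ν ux w q → (∀ z, w a z = uy a z - ux a z) → IsSmoothSpaceTimeOn (Icc a (a + τ)) ζ → IsSmoothSpaceTimeOn (Icc a (a + τ)) π → (∀ t ∈ Icc a (a + τ), IsDivFree (ζ t)) → (∀ t ∈ Icc a (a + τ), ∀ z, Torus.timeDerivWithin (Icc a (a + τ)) ζ t z + convect (ux t) (ζ t) z + convect (ζ t) (ux t) z = ν • laplacian (ζ t) z - Torus.gradient (π t) z + -convect (w t) (w t) z) → (∀ z, ζ a z = 0) → ∀ t ∈ Icc a (a + τ), ∫ z, ‖uy t z - ux t z - w t z - ζ t z‖ ^ 2 ≤ K₃ * ((∫ z, ‖uy a z - ux a z‖ ^ 2) + gradNormSq (fun z => uy a z - ux a z)) ^ 3) :=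
  ⟨fun hν _ _ _ _ _ _ _ hu h₁ h₂ _ ht₀ h0 _ ht => IsLinearizedNSSolutionOn.eq_of_eq hν hu h₁ h₂ ht₀ h0 ht,
    fun hν hK _ _ hτ₀ hτ => IsNSPhase.exists_taylorRemainder_le hν hK hτ₀ hτ,
    fun hν hK _ _ hτ₀ hτ => IsNSPhase.exists_linearised_sub_le hν hK hτ₀ hτ,
    fun hν hK _ _ hτ₀ hτ => IsNSPhase.exists_secondRemainder_le hν hK hτ₀ hτ⟩

end Summit.AnomalousDissipation.AnomalousDissipation.Theorems.DenseLoudDesignerForces.Ergodic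

end
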